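import Summits.RiemannHypothesis.RiemannHypothesis.Theses.WeilWindowFlow
import Summits.RiemannHypothesis.RiemannHypothesis.Theorems.WeilWindowFlowDiniLeakageRelEdgeMassLaw
import Literature.NumberTheory.LFunctions.WeilDilationVirial
import Literature.NumberTheory.LFunctions.WeilGroundState
import Literature.NumberTheory.LFunctions.WeilExplicitFormulaProofs
import Literature.NumberTheory.LFunctions.WeilWindowSuzukiContinuityProofs
import HarnessLib.Audit

/-!
# Line `spectral-virial-shadow` — skeleton for crux `WeilWindowFlow.DiniLeakage`
(item stmt-RiemannHypothesis-1038, route route-RiemannHypothesis-WeilWindowFlow; crux-plan round 1, rev 1, 2026-08-16)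

Crux (BY NAME, never restated): `Summit.RiemannHypothesis.RiemannHypothesis.Theses.WeilWindowFlow.DiniLeakage`
= `∀ b₀ A, 0 < b₀ → b₀ ≤ A → ∃ K, ∀ a ∈ [b₀, A], ∀ η δ > 0, ∃ h ∈ (0, δ), ε a − ε (a + h) ≤ h (K ε a + η)`,
`ε = Literature.NumberTheory.LFunctions.weilGroundEnergy` (lower right-Dini leakage bound, `K` uniform on compact ranges).

## The line (idea card `Cruxes/DiniLeakage/Ideas/spectral-virial-shadow.md`; triage r1: k1 fail — typed transfer
`VirialLeakage` false —, k2 pass + sharpen, k3 pass + mandatory restatement; all three objections are answered by the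
SHAPE of the stubs below, see the line card `Lines/spectral-virial-shadow.md` §Triage answers)

EVALUATE THE LEAKAGE ON THE SPECTRAL SIDE, IN FINITE DIFFERENCES, AT NEAR-GROUND-STATES.  Compress an `L²`-normalised
`θ`-near-minimiser `ψ` of the window `a + h` to the window `a` by Bombieri's dilation `ψ ↦ weilDilate (h/a) ψ`
(tree: unitary, `integral_norm_sq_weilDilate`; support `[−a, a]`, `tsupport_weilDilate_subset`; autocorrelation
`k((1 + h/a)·)`, `k = ψ ⋆ ψ̃`, `weilQuadratic_weilDilate`).  Then `ε a ≤ Re Q(ψ_{h/a})`, and the crux follows from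
`Re Q(ψ_{h/a}) ≤ (1 + hK) Re Q(ψ) + h η'` (glue `leakageStep_of`, SORRY-FREE, then `DiniLeakage_of` with `ε (a+h) ≤ ε a`).
That inequality is Weil's LINEAR functional on ONE explicit test function per `(a, h)`, `L_h := (1 + hK) k − k((1 + h/a)·)`,
NOT of positive type, read on the ZERO SIDE of the explicit formula (`explicit_formula_holds`): with `F(u) := |ψ̂(½ + iu)|²`
an on-line zero `½ + iγ` contributes `(1 + hK) F(γ) − (a/(a+h)) F(aγ/(a+h)) = (h/a)[(aK + 1) F + u F'](γ) + O(h²)` —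
the card's weight `(aK+1)F + uF'`, negative exactly on the SHADOW intervals just below the real zeros of `ψ̂` — and an
off-line zero `ρ` contributes `Re[(1 + hK) k̂(ρ) − (a/(a+h)) k̂(½ + a(ρ − ½)/(a+h))]`, with NO sign.  The skeleton cuts
this zero sum BY HEIGHT, the height `U` being chosen after `h`:

* Stub S `stub_shadowBound` (RH-strength, XL, HARDEST — the bet): the sum over ALL zeros with `|Im ρ| ≤ U`, on the line
  or not, of the weights above is `≥ −hη` at every `θ`-near-minimiser of the window `a + h`, for `θ = θ(…, h, U) > 0`,
  every `U ≥ U₁(…, h)`, one `K = K(b₀, A) ≥ 0`.  A statement about a FINITE sum (`weilZeroSidePartial`), decidable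
  numerically window by window (card F0/F1: at `μ = e^{2a} = 13` every deep zero passes its tolerance by 2–10 orders),
  whose first-order content is the card's displacement–tolerance inequality `(aK+1)·Σ_{low} F ≥ Σ_{low} γ(−F')(γ)`
  over the deep zone (D) and the plunge zone (S), and whose off-line clause is vacuous below height `3.26·10⁷`
  under the tree fact `Brent1979_zerosSimpleOnLine` (all windows `a ≲ 7.7`) and `o(h)` above the plunge by zero-density.
* Stub F `stub_floorDecay` (unconditional REGULARITY of TRUE ground states, L; the card's "band-limited floor", upper
  half): uniformly on compact window ranges, `∫_{|γ| ≥ U} |û(σ + iγ)|² dγ ≤ M e^{2b|σ−½|}/U` in the closed critical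
  strip — the `L²`-modulus `‖u(· + δ) − u‖₂² ≲ δ` (Besov `B^{1/2}_{2,∞}`) of a function with jump-type or milder edges.
* Stub P `stub_proximity` (unconditional FUNCTIONAL ANALYSIS, M): `θ`-near-minimisers of a window are `H^{log}`-close
  (form-norm close) to a TRUE ground state of that window — discreteness of the window form (tree claim
  `ConnesConsaniMoscovici2025_thm_3_6`) + the weak Euler–Lagrange identity; the bridge from near-minimisers to ground
  states that triage r1-1 (G1) asked every line to make explicit.
* Stub T `stub_tailControl : F → P → …` (unconditional given F, P; M/L; where `explicit_formula_holds` is used): for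
  `U ≥ U(…, h)` the zero-side TAILS `Re Q(ψ) − Re Σ_{|Im ρ| ≤ U}` of the near-minimiser and of its dilate are uniformly
  small (`≤ η`, difference `≤ hη`): `Σ_{|γ|>U} ≲ M log U / U + O(θ)` absolutely, off-line zeros included
  (`|k̂(β + iγ)| ≤ e^{2b|β−½|}·(floor)`; `N(T+1) − N(T) ≪ log T`, `riemann_von_mangoldt_holds`; Plancherel–Pólya).

Why finite differences and not the virial: the INFINITESIMAL dilation virial `weilDilationVirial` is unbounded above and
below on every energy sublevel set beyond the dyadic window (triage r1-1 F1 / r1-2 / r1-3 §1, `TriageR13W1.lean`: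
high-frequency contamination `ψ₀ + δe^{iνt}b`), so NO stub quantifies it; at fixed `h` the same contamination moves every
quantity below by `O(θ)`, and `θ` is chosen after `h` (and after `U`).  Why `U` after `h`: at a prime-power window
`a = (log n)/2` the compression un-enters `n` (`k((1+s) log n) → 0`), a genuine leakage `≈ 4Λ(n)n^{-1/2}|u(b)|² h` carried
on the zero side at heights `≳ a/h` (Landau's formula for `Σ_γ n^{iγ}`); with `U ≫ a/h` it sits inside Stub S where the
compensation `(1 + hK)` lives (edge² ≲ K ε: edge slaving), and both tails of Stub T are then INDIVIDUALLY small.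

Registered stubs (4): `stub_shadowBound` (S, XL — HARDEST) · `stub_floorDecay` (F, L) · `stub_proximity` (P, M) ·
`stub_tailControl` (T, M/L).  Composition: `DiniLeakage_of : DiniLeakage` (ZERO hypotheses; the four stubs enter BY NAME through
the sorry-free hypothesis-form glue `leakageStep_of : (S) → (T-conclusion) → leakage step`, axioms `propext/Classical.choice/Quot.sound`;
`sorry` only inside the stubs).  Every signature is written over
EXISTING declarations only (`IsWeilTest`, `weilQuadratic`, `weilGroundEnergy`, `weilZeroSidePartial`, `weilConv`,
`weilReflect`, `weilDilate`, `weilMellin`, `IsWeilGroundState`, Mathlib) — no local `def`, so every stub lands as a pure-proof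
`Theorems/` file `--supports stmt-RiemannHypothesis-1038`.

Disproof.lean honoured (refuter-cdisprove-1038, 2026-08-15T22:38Z; body not mountable in planner jails — read through its
evidence notes, as all three triagers did): `diniLeakage_false_without_b0_pos` / `not_diniLeakageUniformK` — the floor `0 < b₀`
is USED: `K = K(b₀, A)` in S (the plunge height `≍ e^{2A}`, `1/a ≤ 1/b₀`, and `min_{[b₀, A+1]} ε` enter `K`), `M = M(b₀, B)` in F,
and the glue needs `0 < a` to dilate; `diniLeakage_iff_eta0` — the glue spends `η` exactly as the decorative slack it is (`η/2` to S,
`η/(2(K+1))` to T); `diniLeakage_iff_pos_and_lowerRightLipschitz` / `riemannHypothesis_of_diniLeakage` — the RH-strength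
conjunct is isolated in ONE stub (S), F/P/T being RH-neutral; `eps_antitoneOn` re-proved here (`weilGroundEnergy_antitone`).
Near-misses `not_virialBoundedOnNearMinimisers` (cdisprove-1039, sorried) and r1-3's `virialLeakageAll_false_of_unbounded`:
AVOIDED — no virial of any (near-)minimiser appears.  Landed `Theorems/…/DiniLeakage/Negative/`: none
(`ledger negatives --problem RiemannHypothesis` = 0, 2026-08-16); nothing to import in the scratch check.
-/

set_option linter.dupNamespace false

noncomputable section

open MeasureTheory Set Filter
open scoped Topology

namespace Summit.RiemannHypothesis.RiemannHypothesis.Cruxes.DiniLeakage.SpectralVirialShadow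

open Literature.NumberTheory.LFunctions
open Summit.RiemannHypothesis.RiemannHypothesis.Theses.WeilWindowFlow (DiniLeakage)

/-! ### The four registered stubs -/

/-- **Stub S `stub_shadowBound` — the low-zero leakage functional is bounded below at near-ground-states**
(size XL; RH-strength; the HARDEST stub and the bet of the line).
For every compact window range `[b₀, A]` there is `K ≥ 0` (the leakage rate; prediction of the card:
`K ≈ U*(A)/(b₀ ℓ) ≍ e^{2A}`, `U* ≈ 2πe^{2a}` the plunge height where the zero density reaches the window's Nyquist rate)
such that for every `a ∈ [b₀, A]`, `η > 0`, all small `h > 0`, every height `U ≥ U₁(…, h)` and some `θ = θ(…, h, U) > 0`: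
for every `L²`-normalised test function `ψ` on the window `a + h` with `Re Q(ψ) ≤ ε(a+h) + θ` (a `θ`-NEAR-GROUND-STATE),
writing `k = ψ ⋆ ψ̃` and `k_d = k((1 + h/a)·)` (the autocorrelation of the compressed function `weilDilate (h/a) ψ`, tree
`weilConv_weilDilate_weilReflect`),
`(1 + hK) · Re Σ_{|Im ρ| ≤ U} m(ρ) k̂(ρ) − Re Σ_{|Im ρ| ≤ U} m(ρ) k̂_d(ρ) ≥ −hη`   (`Σ_{≤U} = weilZeroSidePartial · U`, a finite sum).
Content (card §Lever, in finite differences): on the line `k̂(½+iγ) = F(γ) := |ψ̂(½+iγ)|²` (`weilMellin_weilQuadratic_of_re_eq`)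
and `k̂_d(½+iγ) = (a/(a+h)) F(aγ/(a+h))` (`weilMellin_comp_mul`), so the summand is `(h/a)[(aK+1)F + uF'](γ) + O(h²)`:
NEGATIVE only on the shadow intervals `(u_j − 2u_j/(aK+3), u_j)` below the real zeros `u_j` of `ψ̂` (real-rooted for a
simple even bottom: Connes–van Suijlekom Thm 6.1, tree fact `Connes2026_weilGroundState_zeros_re_eq_half`).  Three zones:
(D) deep zeros `γ ≪ U*`: `F ≈ c²Ξ²` (Connes arXiv:2602.04022 Fact 6.4), `F(γ_j) ≈ A_j d_j²` with displacement
`d_j = u_j − γ_j`; their first-order cost `2h Σ_j A_j d_j γ_j / a` is NOT signed but is paid by the budget `hK·Σ_{≤U} F ≈ hKε`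
carried by the plunge/far zeros (tolerance `d_j ≤ aKε/(2γ_jA_j)` — passed at `μ = 13` by 2–10 orders on Connes's table, card F0);
(S) plunge zone `γ ≈ U*`: the sidedness bet — no zeta zero sits uncompensated in a shadow; (far) `U* < |γ| ≤ U`: floor
regime, first-order weights `h[(K + 1/a)F + (γ/a)F']`, `Σ γF'` = Landau–Gonek sine sums
(`Σ_{γ≤T} x^{iγ} = −(T/2π)Λ(x)x^{-1/2} + O(log T)`), prime-power un-entering `≈ 4Λ(n)n^{-1/2}|u(b)|²h` paid by `hK·ΣF`
(edge² ≲ Kε on the range), truncation fluctuations beyond `U₁(h) ≫ a/h` bounded by tails (Stub T's estimate).  Off-line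
zeros with `|Im ρ| ≤ U` enter with no sign: below the plunge this is where RH-strength sits (crux ⟹ RH, Disproof
`riemannHypothesis_of_diniLeakage`; at a conjugate point the off-line quadruple leaks at first order) — vacuous below
`3.26·10⁷` under the tree fact `Brent1979_zerosSimpleOnLine`, i.e. for all windows `a ≲ 7.7`; above the plunge they are
quasi-on-line up to `O(δ²b²)` (joining the `F`-analysis) or sparse (`N(σ,T) ≪ T^{1−(σ−½)/4} log T`, Selberg), total `o(h)`.
`θ` after `h` and `U`: high-frequency contamination of near-minimisers moves the finite sum by `O(θ)`.
Why it might fail: an on-line ordinate in the shadow of a plunge-zone zero of `ψ̂_a` with overshoot `< 2γ/(aK+3)` for every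
`K` (card F1, numerics not yet run), or an off-line zero below the plunge height of some window in the range.
Sources: Bombieri2000Weil Thm 5 + Lemma 6 (dilation variation; explicit formula at the extremal); arXiv:2602.04022 §6 (table p.20);
arXiv:2106.01715 §5; arXiv:2511.23257 Thm 6.1; Titchmarsh1986 §9.3–9.4, §9.19 (Selberg); Gonek 1993 doi:10.1090/conm/143/1210528 (uniform Landau formula). -/
theorem stub_shadowBound :
    ∀ b₀ A : ℝ, 0 < b₀ → b₀ ≤ A → ∃ K : ℝ, 0 ≤ K ∧ ∀ a : ℝ, b₀ ≤ a → a ≤ A → ∀ η : ℝ, 0 < η →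
      ∃ h₀ : ℝ, 0 < h₀ ∧ ∀ h : ℝ, 0 < h → h < h₀ → ∃ U₁ : ℝ, ∀ U : ℝ, U₁ ≤ U → ∃ θ : ℝ, 0 < θ ∧
        ∀ ψ : ℝ → ℂ, IsWeilTest ψ → tsupport ψ ⊆ Icc (-(a + h)) (a + h) →
          ∫ t, ‖ψ t‖ ^ 2 = (1 : ℝ) → (weilQuadratic ψ).re ≤ weilGroundEnergy (a + h) + θ →
            -(h * η) ≤ (1 + h * K) * (weilZeroSidePartial (weilConv ψ (weilReflect ψ)) U).re
              - (weilZeroSidePartial (fun t ↦ weilConv ψ (weilReflect ψ) ((1 + h / a) * t)) U).re := by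
  sorry

/-- **Stub F `stub_floorDecay` — the band-limited floor of TRUE ground states** (size L; unconditional regularity,
shared territory with crux `WindowLipschitz`/line `cut-dont-squeeze` Stubs A–B and with card `collar-cut-edge-mass`).
Uniformly on compact window ranges `[b₀, B]` there is `M` such that every ground state `u` of every window
`b ∈ [b₀, B]` (`IsWeilGroundState b u`: `L²`-limit of a normalised minimising sequence; `û = weilMellin u` is entire,
`IsWeilGroundState.differentiable_weilMellin`) has the `L²`-TAIL DECAY of its transform along every vertical line of the
closed critical strip: `γ ↦ |û(σ + iγ)|²` is integrable on `{|γ| ≥ U}` and `∫_{|γ| ≥ U} |û(σ + iγ)|² dγ ≤ M e^{2b|σ − ½|} / U`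
for `U ≥ 1`, `0 ≤ σ ≤ 1` (integrability is part of the statement: no Bochner junk).
Why true: `û(σ+iγ)` is the Fourier transform of `v(t) = u(t)e^{(σ−½)t}` (a function on `[−b, b]`, `‖v‖₂ ≤ e^{b|σ−½|}`), and
the bound is EQUIVALENT (Plancherel) to the Besov `B^{1/2}_{2,∞}` modulus `‖v(·+δ) − v‖²_{L²} ≤ C M e^{2b|σ−½|} δ`, which holds
for bounded functions of bounded variation on the window — jump discontinuities at `±b` allowed (`1_{[−b,b]} ∈ B^{1/2}_{2,∞}`) —
and a fortiori for the expected edge profile `u ~ T(−ln(b − |t|))^{-1/2}` (Hernández-Santamaría–López-Ríos–Saldaña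
arXiv:2401.18033 Thms 1.1–1.4 for the model log-Laplacian; Bombieri2000Weil Lemma 5: `D²f` = bounded + two edge Diracs for
Problem 1) together with interior regularity; the prime-lag echoes of the edges at `±b ∓ log n` are `log`-smoothed, weaker
singularities.  Uniformity in `b ∈ [b₀, B]`: sup bound and edge coefficient are controlled by `ε(b₀)` and the window constants
(sibling line `cut-dont-squeeze`: the sup bound is the LANDED sorry-free tree theorem
`Theorems.WeilWindowFlowWindowLipschitz.stub_supBound`; its pointwise edge law + interior BV ⟹ this).  The floor `0 < b₀` is load-bearing
(`ε(b) → +∞` and `‖u‖_∞` unbounded as `b → 0⁺`, cdisprove-1039 `lipschitzConstant_unbounded`).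
Why it might fail: only through a non-`B^{1/2}_{2,∞}` interior singularity of ground states (not expected); numerically
`|ψ̂_a(½+iu)|² u²` is flat above the plunge (C–C arXiv:2106.01715 Fig. eigen1–3; card (T)).
Sources: Bombieri2000Weil §4 Lemma 5, Thm 3; arXiv:2401.18033; arXiv:2010.10448 Thm 1.1; Young2001 Ch. 2 Thm 16
(Plancherel–Pólya, tree fact `Young2001_thm_2_16_PlancherelPolya`). -/
theorem stub_floorDecay :
    ∀ b₀ B : ℝ, 0 < b₀ → b₀ ≤ B → ∃ M : ℝ, ∀ b : ℝ, b₀ ≤ b → b ≤ B →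
      ∀ u : ℝ → ℂ, IsWeilGroundState b u → ∀ σ : ℝ, 0 ≤ σ → σ ≤ 1 → ∀ U : ℝ, 1 ≤ U →
        IntegrableOn (fun γ : ℝ ↦ ‖weilMellin u ((σ : ℂ) + (γ : ℂ) * Complex.I)‖ ^ 2) {γ : ℝ | U ≤ |γ|} ∧
        ∫ γ in {γ : ℝ | U ≤ |γ|}, ‖weilMellin u ((σ : ℂ) + (γ : ℂ) * Complex.I)‖ ^ 2 ≤
          M * Real.exp (2 * b * |σ - 1 / 2|) / U := by
  sorry

/-- **Stub P `stub_proximity` — near-minimisers are `H^{log}`-close to a true ground state** (size M; unconditional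
functional analysis; the bridge "near-minimiser ⟶ exact ground state" demanded by triage r1-1 (G1) and r1-3 for every line).
For every window `b > 0` and `κ > 0` there is `θ > 0` such that every `L²`-normalised test function `ψ` on `[−b, b]` with
`Re Q(ψ) ≤ ε(b) + θ` is within `κ` of SOME ground state `u` of the window (`IsWeilGroundState b u`) in the weighted Mellin
norm `∫ |(ψ − u)^(½ + iγ)|² (1 + log(1 + |γ|)) dγ ≤ κ` (integrand integrable — part of the statement), i.e. in `H^{log}`,
the form norm of the window up to constants (tree `integral_norm_sq_weilMellin_mul_sub_le`: `∫|ĝ|²(ρ − ρ(0)) ≤ 2π(Re Q(g) + C(b)‖g‖²)`,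
`ρ = reDigammaQuarter ~ log`).  Proof route: by discreteness of the window form (tree claim `ConnesConsaniMoscovici2025_thm_3_6`,
with `…exists_isWeilGroundState`) the bottom `ε(b)` is an isolated eigenvalue of finite multiplicity of the Friedrichs operator,
with ground eigenspace `E_b` (every unit vector of which IS an `IsWeilGroundState`: test functions are a form core) and a gap
`g_b > 0`; for `ψ` in the form domain with `‖ψ‖ = 1`, `Q̄(ψ) = ε‖Pψ‖² + Q̄((1−P)ψ) ≥ ε + g_b‖(1−P)ψ‖²`, so `Re Q(ψ) ≤ ε + θ`
gives `e := (1−P)ψ` with `‖e‖² ≤ θ/g_b` and `(Q̄ − ε)(e) ≤ θ`, hence `‖e‖²_{H^{log}} ≲ θ(1 + (|ε| + C(b))/g_b)`; take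
`u := Pψ/‖Pψ‖` (`‖ψ − u‖_{H^{log}} ≤ ‖e‖_{H^{log}} + (1 − ‖Pψ‖)‖u‖_{H^{log}}`, and `‖u‖_{H^{log}}` is bounded on the unit sphere
of the finite-dimensional `E_b`).  Minimiser-free alternative for the `L²` part: a `θₙ → 0` sequence of near-minimisers IS a
minimising sequence, so by the claim it has an `L²`-convergent subsequence whose limit is a ground state by DEFINITION.
`θ` may depend on `b` (no uniformity in the window is asserted: the gap closes at level crossings, e.g. the even/odd crossing
near `e^{2b} ≈ 2.1–2.27`, kit j006705).  Why it might fail: it does not in substance (isolated finite-multiplicity bottom of a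
closed lower-bounded form with compact resolvent); the Lean size is the closed form `Q̄` on `H^{log}` window functions (the
sibling line's Markov decomposition `weilPoleForm + weilDirichletEnergy` is reusable and its form-domain positivity, ground-state energy and
weak Euler–Lagrange identity are LANDED sorry-free tree theorems: `Theorems.WeilWindowFlowWindowLipschitz.stub_formDomainPos`,
`.stub_groundStateEnergy`, `.stub_eulerLagrange`).
Sources: Bombieri2000Weil §4 Lemma 1 (4.2), Thm 3; arXiv:2511.22755 Prop 3.5, Thm 3.6; Suzuki arXiv:2606.09096 (4.5)–(4.6)
(`H^{log}` form norm); Connes–van Suijlekom arXiv:2511.23257 proof of Thm 6.1 (first display: core approximation). -/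
theorem stub_proximity :
    ∀ b : ℝ, 0 < b → ∀ κ : ℝ, 0 < κ → ∃ θ : ℝ, 0 < θ ∧
      ∀ ψ : ℝ → ℂ, IsWeilTest ψ → tsupport ψ ⊆ Icc (-b) b → ∫ t, ‖ψ t‖ ^ 2 = (1 : ℝ) →
        (weilQuadratic ψ).re ≤ weilGroundEnergy b + θ →
          ∃ u : ℝ → ℂ, IsWeilGroundState b u ∧
            Integrable (fun γ : ℝ ↦ ‖weilMellin (fun t ↦ ψ t - u t) (1 / 2 + (γ : ℂ) * Complex.I)‖ ^ 2 *
              (1 + Real.log (1 + |γ|))) ∧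
            ∫ γ : ℝ, ‖weilMellin (fun t ↦ ψ t - u t) (1 / 2 + (γ : ℂ) * Complex.I)‖ ^ 2 *
              (1 + Real.log (1 + |γ|)) ≤ κ := by
  sorry

/-- **Stub T `stub_tailControl` — uniform smallness of the zero-side tails at near-ground-states, from the floor (F)
and proximity (P)** (size M/L; unconditional given F and P; this is where `explicit_formula_holds` is used).
On every `[b₀, A]`, for every `a ∈ [b₀, A]`, `η > 0`, all small `h > 0` and every `U₁`, there are a height `U ≥ U₁` and
`θ > 0` such that for every `θ`-near-ground-state `ψ` of the window `a + h` (as in Stub S), with `k = ψ ⋆ ψ̃`,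
`k_d = k((1 + h/a)·)`, `ψ_d = weilDilate (h/a) ψ` (so `Q(ψ_d) = W(k_d)`, `weilQuadratic_weilDilate`):
`|Re Q(ψ) − Re Σ_{|Im ρ| ≤ U} m(ρ) k̂(ρ)| ≤ η` and `[Re Q(ψ_d) − Re Σ_{≤U} m k̂_d] − [Re Q(ψ) − Re Σ_{≤U} m k̂] ≤ hη`.
By the explicit formula (`explicit_formula_holds` at `k` and at `k_d`, both test functions: `IsWeilTest.weilConv/.weilReflect/.comp_mul`)
the two brackets ARE the tails `Re Σ_{|Im ρ| > U} m(ρ) k̂(ρ)`, `Re Σ_{|Im ρ|>U} m(ρ) k̂_d(ρ)` (symmetric limits,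
`HasWeilZeroSide`), so it suffices that each is `≤ hη/2` in absolute value, uniformly.  Proof route: by (P) at the window
`b = a + h` write `ψ = u + e`, `u` a ground state, `‖e‖²_{H^{log}} ≤ κ`; then (i) SAMPLING at the ordinates: for a window
function `g`, `Σ_{|γ| > U} |ĝ(½+iγ)|² ≤ C_b Σ_{n ≥ U−1} (log n) ∫_{n−1}^{n+2} |ĝ(½+iu)|² du` (at most `O(log n)` zeros in
`[n, n+1]`, `riemann_von_mangoldt_holds`; local mean value for entire functions of exponential type `b`, Plancherel–Pólya,
tree facts `Young2001_thm_2_16_PlancherelPolya` / `Young2001_thm_2_17_sampling`), hence `≤ C_b κ` for `e` (all heights) and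
`≤ C_b M log U / U` for `u` by (F) (`σ = ½`); cross terms by Cauchy–Schwarz; (ii) OFF-LINE zeros `β + iγ`, `|γ| > U` (if any):
`k̂(ρ) = ψ̂(ρ)·conj ψ̂(1−ρ̄)` (`weilMellin_weilQuadratic`), `|k̂(ρ)| ≤ (|ψ̂(β+iγ)|² + |ψ̂(1−β+iγ)|²)/2`, bounded through (F) on the
vertical lines `Re s = β, 1 − β` (factor `e^{2b|β−½|} ≤ e^{b}`) and through (P) moved off the critical line by Plancherel–Pólya
(`e(t)e^{(σ−½)t}` has `H^{log}` norm `≤ C e^{b|σ−½|}` times that of `e`), same counting with multiplicity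
(`riemannZetaZeroOrder`); (iii) the DILATE: `k̂_d(ρ) = (a/(a+h)) k̂(½ + a(ρ−½)/(a+h))` (`weilMellin_comp_mul`) — the same sums
over the contracted copy of the zero set (same counting function up to the factor `a/(a+h)`), same bounds.  Choose `U` with
`C(M log U / U) ≤ hη/4`, then `κ` (hence `θ`, by (P)) with the `κ`-terms `≤ hη/4`.  The floor `0 < b₀` enters through (F) and
`C_b ≤ C_{A+1}`.  Why it might fail: it does not in substance once (F) and (P) hold (absolutely convergent tails); the Lean size
is the sampling inequality at the zeta ordinates and the strip bookkeeping.
Sources: Bombieri2000Weil Thm 2 (explicit formula; tree `explicit_formula_holds`) and §3 (3.2); Titchmarsh1986 Thm 9.4 (tree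
`riemann_von_mangoldt_holds`); Young2001 Ch. 2 Thms 16–17. -/
theorem stub_tailControl :
    (∀ b₀ B : ℝ, 0 < b₀ → b₀ ≤ B → ∃ M : ℝ, ∀ b : ℝ, b₀ ≤ b → b ≤ B →
      ∀ u : ℝ → ℂ, IsWeilGroundState b u → ∀ σ : ℝ, 0 ≤ σ → σ ≤ 1 → ∀ U : ℝ, 1 ≤ U →
        IntegrableOn (fun γ : ℝ ↦ ‖weilMellin u ((σ : ℂ) + (γ : ℂ) * Complex.I)‖ ^ 2) {γ : ℝ | U ≤ |γ|} ∧
        ∫ γ in {γ : ℝ | U ≤ |γ|}, ‖weilMellin u ((σ : ℂ) + (γ : ℂ) * Complex.I)‖ ^ 2 ≤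
          M * Real.exp (2 * b * |σ - 1 / 2|) / U) →
    (∀ b : ℝ, 0 < b → ∀ κ : ℝ, 0 < κ → ∃ θ : ℝ, 0 < θ ∧
      ∀ ψ : ℝ → ℂ, IsWeilTest ψ → tsupport ψ ⊆ Icc (-b) b → ∫ t, ‖ψ t‖ ^ 2 = (1 : ℝ) →
        (weilQuadratic ψ).re ≤ weilGroundEnergy b + θ →
          ∃ u : ℝ → ℂ, IsWeilGroundState b u ∧
            Integrable (fun γ : ℝ ↦ ‖weilMellin (fun t ↦ ψ t - u t) (1 / 2 + (γ : ℂ) * Complex.I)‖ ^ 2 *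
              (1 + Real.log (1 + |γ|))) ∧
            ∫ γ : ℝ, ‖weilMellin (fun t ↦ ψ t - u t) (1 / 2 + (γ : ℂ) * Complex.I)‖ ^ 2 *
              (1 + Real.log (1 + |γ|)) ≤ κ) →
    ∀ b₀ A : ℝ, 0 < b₀ → b₀ ≤ A → ∀ a : ℝ, b₀ ≤ a → a ≤ A → ∀ η : ℝ, 0 < η →
      ∃ h₀ : ℝ, 0 < h₀ ∧ ∀ h : ℝ, 0 < h → h < h₀ → ∀ U₁ : ℝ, ∃ U : ℝ, U₁ ≤ U ∧ ∃ θ : ℝ, 0 < θ ∧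
        ∀ ψ : ℝ → ℂ, IsWeilTest ψ → tsupport ψ ⊆ Icc (-(a + h)) (a + h) →
          ∫ t, ‖ψ t‖ ^ 2 = (1 : ℝ) → (weilQuadratic ψ).re ≤ weilGroundEnergy (a + h) + θ →
            |(weilQuadratic ψ).re - (weilZeroSidePartial (weilConv ψ (weilReflect ψ)) U).re| ≤ η ∧
            ((weilQuadratic (weilDilate (h / a) ψ)).re
                - (weilZeroSidePartial (fun t ↦ weilConv ψ (weilReflect ψ) ((1 + h / a) * t)) U).re)
              - ((weilQuadratic ψ).re - (weilZeroSidePartial (weilConv ψ (weilReflect ψ)) U).re)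
                ≤ h * η := by
  sorry

/-! ### Sorry-free glue -/

/-- Antitonicity of the window bottom: a larger window has a smaller bottom (`sInf` over a larger, still
bounded-below set; the smaller sphere is nonempty).  Proved here so that the composition is sorry-free; the
disprover's `eps_antitoneOn` (Disproof.lean) and `SketchIdeator2.weilGroundEnergy_antitone` are the same statement. -/
theorem weilGroundEnergy_antitone {a b : ℝ} (hb : 0 < b) (hba : b ≤ a) :
    weilGroundEnergy a ≤ weilGroundEnergy b := by
  obtain ⟨g, hg, hs, hn⟩ := exists_isWeilTest_sphere hb
  refine le_csInf ⟨_, g, hg, hs, hn, rfl⟩ ?_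
  rintro x ⟨h, hh, hhs, hhn, rfl⟩
  exact csInf_le (bddBelow_weilQuadratic_sphere_holds a)
    ⟨h, hh, hhs.trans (Icc_subset_Icc (neg_le_neg hba) hba), hhn, rfl⟩

/-- **Bombieri's compression is admissible**: the dilate `weilDilate (h/a) ψ` of a normalised test function of the
window `a + h` is a normalised test function of the window `a`, hence bounds `ε a` from above (tree:
`IsWeilTest.weilDilate`, `tsupport_weilDilate_subset`, `integral_norm_sq_weilDilate`, `weilGroundEnergy_le_re_weilQuadratic`). -/
theorem weilGroundEnergy_le_re_weilQuadratic_weilDilate {a h : ℝ} (ha : 0 < a) (hh : 0 < h)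
    {ψ : ℝ → ℂ} (hψ : IsWeilTest ψ) (hsupp : tsupport ψ ⊆ Icc (-(a + h)) (a + h))
    (hnorm : ∫ t, ‖ψ t‖ ^ 2 = (1 : ℝ)) :
    weilGroundEnergy a ≤ (weilQuadratic (weilDilate (h / a) ψ)).re := by
  have hη' : (-1 : ℝ) < h / a := by
    have : 0 < h / a := div_pos hh ha
    linarith
  have hsupp' : tsupport (weilDilate (h / a) ψ) ⊆ Icc (-a) a := by
    have hs := tsupport_weilDilate_subset ψ hη' hsupp
    have hscale : (a + h) / (1 + h / a) = a := by
      field_simp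
    simpa [hscale] using hs
  have hnorm' : ∫ t : ℝ, ‖weilDilate (h / a) ψ t‖ ^ 2 = 1 := by
    rw [integral_norm_sq_weilDilate ψ hη', hnorm]
  exact weilGroundEnergy_le_re_weilQuadratic (hψ.weilDilate hη') hsupp' hnorm'

/-- **The tails of Stub T ARE zero-side tails** (sorry-free sanity lemma, the interpretation step of (T); not a stub):
by the PROVED explicit formula `explicit_formula_holds`, for a test function `ψ` the symmetric partial zero sums of
`k = ψ ⋆ ψ̃` converge to `Q(ψ) = W(k)` (definition of `weilQuadratic`), and those of the rescaled kernel
`k((1 + h/a)·)` — a test function by `IsWeilTest.comp_mul` — converge to `Q(weilDilate (h/a) ψ)` (`weilQuadratic_weilDilate`).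
Hence `Re Q(ψ) − Re (weilZeroSidePartial k U)` and its dilated twin in (T) are exactly `lim_T Re Σ_{U < |Im ρ| ≤ T} m(ρ) k̂(ρ)`. -/
theorem hasWeilZeroSide_kernel_and_dilate {ψ : ℝ → ℂ} (hψ : IsWeilTest ψ) {a h : ℝ} (ha : 0 < a)
    (hh : 0 < h) :
    HasWeilZeroSide (weilConv ψ (weilReflect ψ)) (weilQuadratic ψ) ∧
      HasWeilZeroSide (fun t ↦ weilConv ψ (weilReflect ψ) ((1 + h / a) * t))
        (weilQuadratic (weilDilate (h / a) ψ)) := by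
  have hk : IsWeilTest (weilConv ψ (weilReflect ψ)) := hψ.weilConv hψ.weilReflect
  have hpos : 0 < 1 + h / a := by
    have : 0 < h / a := div_pos hh ha
    linarith
  have hη' : (-1 : ℝ) < h / a := by linarith
  refine ⟨explicit_formula_holds hk, ?_⟩
  rw [weilQuadratic_weilDilate ψ hη']
  exact explicit_formula_holds (hk.comp_mul (ne_of_gt hpos))

/-- **The one-window leakage bound from the statements of (S) and (T)** (sorry-free; hypotheses are the stub
STATEMENTS — (T) with its own antecedents (F), (P) already discharged —, conclusion is NOT the crux): on `[b₀, A]`, with the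
`K ≥ 0` of (S), for every `a ∈ [b₀, A]`, `η > 0` and `δ > 0` there is `h ∈ (0, δ)` with `ε a ≤ (1 + hK) ε(a + h) + hη`.
Proof: split `η = η/2 + (K+1)·η/(2(K+1))`; take `h` below the two `h₀`'s and `δ`; `U₁` from (S), `U ≥ U₁` and `θ₂`
from (T), `θ₁` from (S) at `U`; for every `θ' ≤ min θ₁ θ₂` pick a `θ'`-near-minimiser `ψ` of the window `a + h`
(`exists_re_weilQuadratic_lt`); with `q, q'` the energies of `ψ` and of its dilate and `z, z'` the two low zero sums,
(S) gives `z' ≤ (1+hK) z + hη/2`, (T) gives `|q − z| ≤ η₁` and `(q' − z') − (q − z) ≤ hη₁`, whence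
`ε a ≤ q' ≤ (1+hK) q + h(Kη₁ + η₁ + η/2) ≤ (1+hK)(ε(a+h) + θ') + hη`; let `θ' → 0`. -/
theorem leakageStep_of
    (hS : ∀ b₀ A : ℝ, 0 < b₀ → b₀ ≤ A → ∃ K : ℝ, 0 ≤ K ∧ ∀ a : ℝ, b₀ ≤ a → a ≤ A → ∀ η : ℝ, 0 < η →
      ∃ h₀ : ℝ, 0 < h₀ ∧ ∀ h : ℝ, 0 < h → h < h₀ → ∃ U₁ : ℝ, ∀ U : ℝ, U₁ ≤ U → ∃ θ : ℝ, 0 < θ ∧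
        ∀ ψ : ℝ → ℂ, IsWeilTest ψ → tsupport ψ ⊆ Icc (-(a + h)) (a + h) →
          ∫ t, ‖ψ t‖ ^ 2 = (1 : ℝ) → (weilQuadratic ψ).re ≤ weilGroundEnergy (a + h) + θ →
            -(h * η) ≤ (1 + h * K) * (weilZeroSidePartial (weilConv ψ (weilReflect ψ)) U).re
              - (weilZeroSidePartial (fun t ↦ weilConv ψ (weilReflect ψ) ((1 + h / a) * t)) U).re)
    (hT : ∀ b₀ A : ℝ, 0 < b₀ → b₀ ≤ A → ∀ a : ℝ, b₀ ≤ a → a ≤ A → ∀ η : ℝ, 0 < η →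
      ∃ h₀ : ℝ, 0 < h₀ ∧ ∀ h : ℝ, 0 < h → h < h₀ → ∀ U₁ : ℝ, ∃ U : ℝ, U₁ ≤ U ∧ ∃ θ : ℝ, 0 < θ ∧
        ∀ ψ : ℝ → ℂ, IsWeilTest ψ → tsupport ψ ⊆ Icc (-(a + h)) (a + h) →
          ∫ t, ‖ψ t‖ ^ 2 = (1 : ℝ) → (weilQuadratic ψ).re ≤ weilGroundEnergy (a + h) + θ →
            |(weilQuadratic ψ).re - (weilZeroSidePartial (weilConv ψ (weilReflect ψ)) U).re| ≤ η ∧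
            ((weilQuadratic (weilDilate (h / a) ψ)).re
                - (weilZeroSidePartial (fun t ↦ weilConv ψ (weilReflect ψ) ((1 + h / a) * t)) U).re)
              - ((weilQuadratic ψ).re - (weilZeroSidePartial (weilConv ψ (weilReflect ψ)) U).re)
                ≤ h * η) :
    ∀ b₀ A : ℝ, 0 < b₀ → b₀ ≤ A → ∃ K : ℝ, 0 ≤ K ∧ ∀ a : ℝ, b₀ ≤ a → a ≤ A → ∀ η δ : ℝ, 0 < η → 0 < δ →
      ∃ h : ℝ, 0 < h ∧ h < δ ∧
        weilGroundEnergy a ≤ (1 + h * K) * weilGroundEnergy (a + h) + h * η := by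
  intro b₀ A hb₀ hb₀A
  obtain ⟨K, hK0, hS'⟩ := hS b₀ A hb₀ hb₀A
  have hT' := hT b₀ A hb₀ hb₀A
  refine ⟨K, hK0, fun a hba haA η δ hη hδ ↦ ?_⟩
  have ha : 0 < a := lt_of_lt_of_le hb₀ hba
  -- split the slack
  have hK1 : 0 < K + 1 := by linarith
  set η₁ : ℝ := η / (2 * (K + 1)) with hη₁def
  have hη₁ : 0 < η₁ := by positivity
  have hη₂ : 0 < η / 2 := by positivity
  obtain ⟨h₁, hh₁, hS1⟩ := hS' a hba haA (η / 2) hη₂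
  obtain ⟨h₂, hh₂, hT1⟩ := hT' a hba haA η₁ hη₁
  -- the width `h`
  set h : ℝ := min (min h₁ h₂) δ / 2 with hhdef
  have hm : 0 < min (min h₁ h₂) δ := lt_min (lt_min hh₁ hh₂) hδ
  have hh : 0 < h := by positivity
  have hhlt : h < min (min h₁ h₂) δ := by
    rw [hhdef]; linarith
  have hh1 : h < h₁ := lt_of_lt_of_le hhlt ((min_le_left _ _).trans (min_le_left _ _))
  have hh2 : h < h₂ := lt_of_lt_of_le hhlt ((min_le_left _ _).trans (min_le_right _ _))
  have hhδ : h < δ := lt_of_lt_of_le hhlt (min_le_right _ _)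
  obtain ⟨U₁, hS2⟩ := hS1 h hh hh1
  obtain ⟨U, hU, θ₂, hθ₂, hT2⟩ := hT1 h hh hh2 U₁
  obtain ⟨θ₁, hθ₁, hS3⟩ := hS2 U hU
  refine ⟨h, hh, hhδ, ?_⟩
  have hhK : 0 ≤ h * K := mul_nonneg hh.le hK0
  -- the bound for every small `θ'`
  have key : ∀ θ' : ℝ, 0 < θ' → θ' ≤ min θ₁ θ₂ →
      weilGroundEnergy a ≤ (1 + h * K) * (weilGroundEnergy (a + h) + θ') + h * η := by
    intro θ' hθ' hθ'le
    obtain ⟨ψ, hψ, hsupp, hnorm, hQ⟩ :=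
      exists_re_weilQuadratic_lt (a := a + h) (ε := θ') (by linarith) hθ'
    have hQ1 : (weilQuadratic ψ).re ≤ weilGroundEnergy (a + h) + θ₁ := by
      linarith [min_le_left θ₁ θ₂]
    have hQ2 : (weilQuadratic ψ).re ≤ weilGroundEnergy (a + h) + θ₂ := by
      linarith [min_le_right θ₁ θ₂]
    have hSψ := hS3 ψ hψ hsupp hnorm hQ1
    obtain ⟨hTa, hTb⟩ := hT2 ψ hψ hsupp hnorm hQ2
    have hle := weilGroundEnergy_le_re_weilQuadratic_weilDilate ha hh hψ hsupp hnorm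
    -- abbreviations
    set q : ℝ := (weilQuadratic ψ).re with hq
    set q' : ℝ := (weilQuadratic (weilDilate (h / a) ψ)).re with hq'
    set z : ℝ := (weilZeroSidePartial (weilConv ψ (weilReflect ψ)) U).re with hz
    set z' : ℝ := (weilZeroSidePartial (fun t ↦ weilConv ψ (weilReflect ψ) ((1 + h / a) * t)) U).re
      with hz'
    have hz1 : z ≤ q + η₁ := by
      have := (abs_le.1 hTa).1
      linarith
    have h1 : z' ≤ (1 + h * K) * z + h * (η / 2) := by linarith
    have h2 : q' ≤ z' + (q - z) + h * η₁ := by linarith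
    have h3 : (h * K) * z ≤ (h * K) * (q + η₁) := mul_le_mul_of_nonneg_left hz1 hhK
    have h4 : q' ≤ (1 + h * K) * q + h * (K * η₁ + η₁ + η / 2) := by nlinarith
    have h5 : (1 + h * K) * q ≤ (1 + h * K) * (weilGroundEnergy (a + h) + θ') :=
      mul_le_mul_of_nonneg_left hQ.le (by linarith)
    have h6 : K * η₁ + η₁ + η / 2 = η := by
      rw [hη₁def]
      field_simp
      ring
    calc weilGroundEnergy a ≤ q' := hle
      _ ≤ (1 + h * K) * q + h * (K * η₁ + η₁ + η / 2) := h4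
      _ = (1 + h * K) * q + h * η := by rw [h6]
      _ ≤ (1 + h * K) * (weilGroundEnergy (a + h) + θ') + h * η := by linarith
  -- let `θ' → 0`
  refine le_of_forall_pos_lt_add fun θ hθ ↦ ?_
  have h1K : 0 < 1 + h * K := by linarith
  set θ' : ℝ := min (min θ₁ θ₂) (θ / (2 * (1 + h * K))) with hθ'def
  have hθ' : 0 < θ' := lt_min (lt_min hθ₁ hθ₂) (by positivity)
  have hθ'le : θ' ≤ min θ₁ θ₂ := min_le_left _ _
  have hθ'small : (1 + h * K) * θ' ≤ θ / 2 := by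
    have hle' : θ' ≤ θ / (2 * (1 + h * K)) := min_le_right _ _
    calc (1 + h * K) * θ' ≤ (1 + h * K) * (θ / (2 * (1 + h * K))) :=
          mul_le_mul_of_nonneg_left hle' h1K.le
      _ = θ / 2 := by field_simp
  have := key θ' hθ' hθ'le
  nlinarith

/-! ### The composition (concludes the crux BY NAME; the four stubs enter BY NAME; zero hypotheses) -/

/-- **`DiniLeakage` from the four registered stubs** — the skeleton's crux proof term (zero hypotheses; `sorry` only
inside the four `stub_*`): (S) `stub_shadowBound`, (F) `stub_floorDecay`, (P) `stub_proximity`, (T) `stub_tailControl`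
(which consumes (F) and (P)) feed the sorry-free `leakageStep_of`, and `ε(a+h) ≤ ε a` (`weilGroundEnergy_antitone`) with
`K ≥ 0` turns `ε a ≤ (1 + hK) ε(a+h) + hη` into the crux's `ε a − ε(a+h) ≤ h (K ε a + η)`.  This is the ONLY theorem of the
file concluding the crux (the skeleton registry takes it); all real content of the glue is in the sorry-free, hypothesis-form
`leakageStep_of` (axioms `propext/Classical.choice/Quot.sound`), whose two hypotheses are LITERALLY the statements of (S) and of
(T)'s conclusion, so statements proved under any names close the crux by replaying these twelve lines. -/
theorem DiniLeakage_of : DiniLeakage := by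
  have hS := stub_shadowBound
  have hF := stub_floorDecay
  have hP := stub_proximity
  have hT := stub_tailControl hF hP
  intro b₀ A hb₀ hb₀A
  obtain ⟨K, hK0, hstep⟩ := leakageStep_of hS hT b₀ A hb₀ hb₀A
  refine ⟨K, fun a hba haA η δ hη hδ ↦ ?_⟩
  obtain ⟨h, hh, hhδ, hmain⟩ := hstep a hba haA η δ hη hδ
  refine ⟨h, hh, hhδ, ?_⟩
  have ha : 0 < a := lt_of_lt_of_le hb₀ hba
  have hanti : weilGroundEnergy (a + h) ≤ weilGroundEnergy a :=
    weilGroundEnergy_antitone ha (by linarith)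
  have hhK : 0 ≤ h * K := mul_nonneg hh.le hK0
  have h1 : (h * K) * weilGroundEnergy (a + h) ≤ (h * K) * weilGroundEnergy a :=
    mul_le_mul_of_nonneg_left hanti hhK
  nlinarith

end Summit.RiemannHypothesis.RiemannHypothesis.Cruxes.DiniLeakage.SpectralVirialShadow

end

/-! ### Costume certificate (line lead `prover-line-stmt-RiemannHypothesis-1038-1`, 2026-08-16)

Since 2026-08-16T08:12Z the TREE holds
`Summit.RiemannHypothesis.RiemannHypothesis.Theorems.WeilWindowFlowDiniLeakage.diniLeakage_iff_mathlib_riemannHypothesis :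
DiniLeakage ↔ RiemannHypothesis` (p90716; axioms `propext/Classical.choice/Quot.sound`).  Read through it, this skeleton is a
skeleton OF THE RIEMANN HYPOTHESIS: the statements of its four registered stubs prove Mathlib's `RiemannHypothesis`
(`riemannHypothesis_of_stubs`, sorry-free in hypothesis form — the twelve glue lines of `DiniLeakage_of` replayed).  As (F), (P),
(T) are unconditional analysis (RH-neutral by design, line card §Stubs), the bet (S) `stub_shadowBound` is ≥ RH modulo them; the
converse `RiemannHypothesis → (S)` is NOT available in the tree (it is the Hadamard/Danskin variation theory of `Q` under
compression at true ground states — the absent `hasDerivAt_re_weilQuadratic_weilDilate` layer), so (S) may even be STRONGER than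
the summit.  Either way the line cannot close the crux short of proving RH: it is the crux — i.e. the summit — in costume
(triage criterion "equivalent-hardness transfer with no stated gain", now a kernel theorem rather than a judgement).
No stub of this line is refuted. -/

namespace Summit.RiemannHypothesis.RiemannHypothesis.Cruxes.DiniLeakage.SpectralVirialShadow

open MeasureTheory Set Filter
open Literature.NumberTheory.LFunctions
open Summit.RiemannHypothesis.RiemannHypothesis.Theses.WeilWindowFlow (DiniLeakage)

/-- **The crux from the STATEMENTS of the four stubs** (hypothesis form of `DiniLeakage_of`; sorry-free). -/
theorem diniLeakage_of_stubs
    (hS : type_of% stub_shadowBound) (hF : type_of% stub_floorDecay) (hP : type_of% stub_proximity)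
    (hT : type_of% stub_tailControl) : DiniLeakage := by
  have hT' := hT hF hP
  intro b₀ A hb₀ hb₀A
  obtain ⟨K, hK0, hstep⟩ := leakageStep_of hS hT' b₀ A hb₀ hb₀A
  refine ⟨K, fun a hba haA η δ hη hδ ↦ ?_⟩
  obtain ⟨h, hh, hhδ, hmain⟩ := hstep a hba haA η δ hη hδ
  refine ⟨h, hh, hhδ, ?_⟩
  have ha : 0 < a := lt_of_lt_of_le hb₀ hba
  have hanti : weilGroundEnergy (a + h) ≤ weilGroundEnergy a :=
    weilGroundEnergy_antitone ha (by linarith)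
  have hhK : 0 ≤ h * K := mul_nonneg hh.le hK0
  have h1 : (h * K) * weilGroundEnergy (a + h) ≤ (h * K) * weilGroundEnergy a :=
    mul_le_mul_of_nonneg_left hanti hhK
  nlinarith

/-- **COSTUME CERTIFICATE: the statements of the four registered stubs prove the Riemann hypothesis** (Mathlib's
`RiemannHypothesis`; sorry-free in hypothesis form; through the tree theorem `diniLeakage_iff_mathlib_riemannHypothesis`). -/
theorem riemannHypothesis_of_stubs
    (hS : type_of% stub_shadowBound) (hF : type_of% stub_floorDecay) (hP : type_of% stub_proximity)
    (hT : type_of% stub_tailControl) : _root_.RiemannHypothesis :=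
  (_root_.Summit.RiemannHypothesis.RiemannHypothesis.Theorems.WeilWindowFlowDiniLeakage.diniLeakage_iff_mathlib_riemannHypothesis).1
    (diniLeakage_of_stubs hS hF hP hT)

/-- **The bet is ≥ RH modulo the unconditional stubs**: given (F), (P), (T), Stub S implies the Riemann hypothesis. -/
theorem riemannHypothesis_of_shadowBound (hF : type_of% stub_floorDecay) (hP : type_of% stub_proximity)
    (hT : type_of% stub_tailControl) (hS : type_of% stub_shadowBound) : _root_.RiemannHypothesis :=
  riemannHypothesis_of_stubs hS hF hP hT

/-- Conversely the crux itself is implied by RH (tree theorem), so NOTHING this line proves can be logically cheaper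
than the summit: `DiniLeakage` needs no stub at all once `RiemannHypothesis` is known. -/
theorem diniLeakage_of_riemannHypothesis (hRH : _root_.RiemannHypothesis) : DiniLeakage :=
  (_root_.Summit.RiemannHypothesis.RiemannHypothesis.Theorems.WeilWindowFlowDiniLeakage.diniLeakage_iff_mathlib_riemannHypothesis).2
    hRH

/-- The skeleton's own zero-hypothesis proof term, read through the calibration: a "proof" of RH whose only gaps are
the four `sorry`s of the stubs (documentation of the costume; `sorryAx` in its cone by construction). -/
theorem riemannHypothesis_of_skeleton : _root_.RiemannHypothesis :=
  riemannHypothesis_of_stubs stub_shadowBound stub_floorDecay stub_proximity stub_tailControl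

end Summit.RiemannHypothesis.RiemannHypothesis.Cruxes.DiniLeakage.SpectralVirialShadow
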